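import Literature.MathematicalPhysics.QuantumFieldTheory.Balaban1983to89.B9Eq353FormDefectTowerDiagonal
import Literature.MathematicalPhysics.QuantumFieldTheory.Balaban1983to89.B7Eq43AveragedSmallnessLinearFeed
import Literature.MathematicalPhysics.QuantumFieldTheory.Balaban1983to89.B9Eq325RLipschitzSqrtTowerPackaged

/-!
# `Balaban1983to89.B9Eq353FormDefectTowerTwoWindows` — T. Bałaban, *Propagators for lattice gauge theories in a background field*, Commun. Math. Phys. **99**
# (1985) 389–434 [Balaban1985BackgroundPropagators] (3.52)–(3.53) p. 400 *«Δ_{U′U} = Δ_U − V₁(A)»* with Thm 3.11 p. 416 and (3.35)–(3.37) p. 396 AT `k = n+1`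
# AVERAGING LEVELS ON PRINT's DIAGONAL `ηL^{n+1} = 1`: **THE ENERGY DATA OF THE PAIR `(Δ^{(k)}_a(U), Δ^{(k)}_a(1))` ON PRINT's CLASS (3.35) WITH NO OPERATOR
# LETTER AND NO PROFILE BINDER** — the row OWNER's `B9Eq353FormDefectTowerDiagonal.exists_energy_pair_diagonal_closed` (g86 INTENT-4a) with the binders
# `εU ∕ hεU ∕ hUε ∕ hεg ∕ r ∕ hUb` AND the `R`-letter `hR ∕ C_R` STRUCK: the profile fed α-LINEARLY from the two windows (`B7Eq43AveragedSmallnessLinearFeed`),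
# the `R`-letter from the package (`B9Eq325RLipschitzSqrtTowerPackaged`)

statement-level skeleton of published theorems with citation tags; proofs where landed; nothing here is a claim about the Yang–Mills mass gap

CITATION HEADER (lean-in-tree rule).  Audit cell `pub-balaban`, sub-cell `t4`, BINDER row NE9; filed by NE9 formalisation-swarm leaf prover 03
(`b2b-balaban-t4-ne9-formalise-leaf-03`, gen 66), INTENT I-ne9leaf03-g66-C.  Sources READ in the held text `paper:balaban1985-cmp99-background-propagators`
pp. 396, 400, 407, 416.  Objects BY NAME: the owner's `laplaceAk`, `QkW`, `RofUk`; `covCurlL2K`, `covDivL2K`; nothing re-declared, 0 `def`.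

THE PRINT (verbatim).  p. 400 (3.52)–(3.53): *«Let us denote the first order operator on the right-hand side above by V₁(A) … Δ_{U′U} = Δ_U − V₁(A)»*;
p. 396 (3.35): the TWO displays of the small-field class — bonds `αη`, plaquettes `αη²` — of which the averaged configurations' smallness (3.37) is a consequence.

WHY THIS FILE (cell context).  The OWNER's 4a exports the three data every energy-norm perturbation on the diagonal consumes (strong coercivity at `U`, at the
flat background, and the FIRST-ORDER FORM DEFECT `‖⟨u, (Δ_a(U) − Δ_a(1))v⟩‖ ≤ Θ̄·α·N₁(u)N₁(v)`) modulo the displayed level profile `ε_j ≤ αr^j` and the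
`R`-letter `C_R`.  Both are theorems of the tree on print's class: the profile by this lineage's α-LINEAR feed (class parameter `2α`; the conclusion (iii) is
`α`-linear, so the fixed-parameter feed of `B9Thm311SmallFieldCoercivityTowerTwoWindows` would not do), the `R`-letter by ne9-leaf-04's α-linear letter packaged.
Result: the energy data with `∃ α₀ γ₁ Θ̄` before every binder and, as hypotheses, exactly print's two windows of (3.35) + E162's per-level data + `hRS` + `S`
averaging-closed — the same display as `B9Thm311SmallFieldCoercivityTowerTwoWindows` (SC-k) and `B9Eq3153FrakGkBoundTwoWindows` (the Green's letters).

WHAT IS PROVED (sorry-free; proof lane — 0 `def`; [folklore] binder plumbing over landed files).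
* **`exists_energy_pair_twoWindows`** — `∃ α₀ γ₁ Θ̄ > 0` (`γ₁ = γ(d,a)∕4`; `Θ̄ = K·Θ̄^{4a}(C_R, r = 1∕L)`, `K = 1 + 512(d+1)(d+4)`) BEFORE `∀ n η (ηL^{n+1} = 1) c₀ c₁
  (c₀(L^{n+1})^d = c₁) (|η|^d∕c₀ ≤ ρ_w) m U (E162's data) S (AvgClosed) (U(b) ∈ S) α (0 ≤ α ≤ α₀) hRS (‖U(b) − 1‖ ≤ αη) (‖U(∂p) − 1‖ ≤ αη²)`, then (i) (ii) the two
  strong coercivities `γ₁(‖curl₁x‖² + ‖div₁x‖² + ‖x‖²) ≤ re⟨x, Δ_a x⟩` at `U` and at the flat background, (iii) `‖⟨u, Δ_a(U)v⟩ − ⟨u, Δ_a(1)v⟩‖ ≤ Θ̄·α·N₁(u)N₁(v)`.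
HONEST SCOPE.  [folklore]; FIRST order at the flat point on the diagonal ONLY; the two WINDOWS, E162's data, `hRS`, `C_τ`, `ρ_w` stay HYPOTHESES; the fine-bond
window is NOT derived from plaquettes (torus holonomies; per cube = the IMS road); no kernel bound, no decay; «NE9 ⇐ the named binders»; NE9 NOT PRINTED ∕ NOT
PROVED; NOT summit progress (cell pub-balaban: row NE9 WALLED ON A MODEL (O-NE9-1; #5 UNRULED); spine PROVED 0/9; rung (B)+1 finite T⁴ — NOT infinite volume, NOT
mass gap, NOT BetaPertH, NOT Clay; HONEST DEPENDENCY: continuum YM on T⁴ ⇐ BetaPertH ∧ nine spine estimates (0/9 proved); BetaPertH ⇐ (D1) ∧ (D4) ∧ CAP+tail;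
G-an2-4 gates asym, D1 and NE2/3/4).  NEW file; nothing modified.  Net new unproved facts: 0.
-/

noncomputable section

open scoped InnerProductSpace ComplexConjugate BigOperators

namespace Literature.MathematicalPhysics.QuantumFieldTheory.Balaban1983to89.B9Eq353FormDefectTowerTwoWindows

open B4Sect5Torus (TSite)
open B9SectCLatticeCarrier (Bond)
open B11Eq103H1Complex (BondL2K covDivL2K)
open B9Eq310HessianOperator (adTransportW covCurlL2K)
open B9Eq310DeltaPrime (plaqHolU)
open B9Eq315QTorus (perCfg cornerSite)
open B9Eq315QTower (towerP UlevOf)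
open B9Eq315QTowerFlat (perCfg_UlevOf_one_mem_U1 norm_Wcx_UlevOf_one_sub_one_le)
open B9Eq326OperatorTower (laplaceAk)
open B7Prop1Explicit (U1 Wcx boxVec)
open B7Prop2Explicit (AvgClosed)
open B9Eq353FormDefectTowerDiagonal (exists_energy_pair_diagonal_closed)
open B7Eq43AveragedSmallnessLinearFeed (twoWindows_linear_feed)
open B9Eq325RLipschitzSqrtTowerPackaged (exists_norm_RofUk_sub_RofUk_one_le_diagonal)

variable {d : ℕ} (L : ℕ) [NeZero L] (hL : 1 ≤ L) (hL2 : 2 ≤ L)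
  {𝔸 : Type*} [NormedRing 𝔸] [NormedAlgebra ℂ 𝔸] [CompleteSpace 𝔸] [NormOneClass 𝔸] [StarRing 𝔸] [NormedStarGroup 𝔸] [StarModule ℂ 𝔸]
  {W : Type*} [NormedAddCommGroup W] [InnerProductSpace ℂ W] [FiniteDimensional ℂ W] (φ : W ≃ₗ[ℂ] 𝔸)
  {Mφ Mφ' : ℝ} (hMφ : 0 ≤ Mφ) (hMφ' : 0 ≤ Mφ') (hφ : ∀ w, ‖φ w‖ ≤ Mφ * ‖w‖) (hφ' : ∀ X, ‖φ.symm X‖ ≤ Mφ' * ‖X‖)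
  {a : ℝ} (ha : 0 < a) (τ : 𝔸 →ₗ[ℂ] ℂ) {Cτ : ℝ} (hτ : ∀ X, ‖τ X‖ ≤ Cτ * ‖X‖) (hCτ : 0 ≤ Cτ) {ρw : ℝ} (hρw : 0 ≤ ρw)

include hL2 hMφ hMφ' hφ hφ' ha hτ hCτ hρw

/-- **THE ENERGY DATA OF THE PAIR `(Δ^{(n+1)}_a(U), Δ^{(n+1)}_a(1))` ON PRINT's CLASS (3.35), NO OPERATOR LETTER, NO PROFILE BINDER**: there are
`α₀, γ₁, Θ̄ > 0` (closed in `(d, a, L, M_φ, M_φ′, C_τ, ρ_w)`; `γ₁ = γ(d,a)∕4`) such that for every `n`, `η` (`ηL^{n+1} = 1`), `c₀, c₁` (`c₀(L^{n+1})^d = c₁`,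
`|η|^d∕c₀ ≤ ρ_w`), `m`, background `U` of E162's data valued in an averaging-closed `S`, `0 ≤ α ≤ α₀`, `hRS`, the two windows `‖U(b) − 1‖ ≤ αη`,
`‖U(∂p) − 1‖ ≤ αη²`: (i) `γ₁(‖curl₁x‖² + ‖div₁x‖² + ‖x‖²) ≤ re⟨x, Δ_a(U)x⟩`, (ii) the same at the canonical flat background, (iii) THE FORM DEFECT
`‖⟨u, Δ_a(U)v⟩ − ⟨u, Δ_a(1)v⟩‖ ≤ Θ̄·α·N₁(u)N₁(v)` — the OWNER's `exists_energy_pair_diagonal_closed` at `r = 1∕L`, `C_R` := the packaged `R`-letter's, fed at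
`β = Kα` by `twoWindows_linear_feed`. [cite: Balaban1985BackgroundPropagators, (3.52)–(3.53) p.400, (3.82)–(3.86) p.407, Thm 3.11 p.416, (3.35)–(3.37) p.396; Balaban1985Averaging, Prop. 2 (52)–(54) p.26] -/
theorem exists_energy_pair_twoWindows :
    ∃ α₀ γ₁ Θ : ℝ, 0 < α₀ ∧ 0 < γ₁ ∧ 0 < Θ ∧ ∀ (n : ℕ) (η : ℝ), η * (L : ℝ) ^ (n + 1) = 1 →
      ∀ (c₀ c₁ : ℝ) [Fact (0 < c₀)] [Fact (0 < c₁)], c₀ * ((L : ℝ) ^ (n + 1)) ^ d = c₁ → |η| ^ d / c₀ ≤ ρw →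
      ∀ (m : Fin d → ℕ) [∀ i, NeZero (m i)] (U : Bond d (towerP L m (n + 1)) → 𝔸ˣ) (αU : ℕ → ℝ) (hα1 : ∀ j, αU j ≤ 1 / 64)
        (hU1 : ∀ (j : ℕ) (x : B7Prop1Explicit.Site d) (κ : Fin d), perCfg (towerP L m (j + 1)) (UlevOf L m (n + 1) U j) x κ ∈ U1 𝔸)
        (hreg : ∀ (j : ℕ) (y : TSite d (towerP L m j)) (κ : Fin d) (r : Fin d → Fin L),
          ‖((Wcx L (perCfg (towerP L m (j + 1)) (UlevOf L m (n + 1) U j)) (cornerSite L y) κ (boxVec L r) : 𝔸ˣ) : 𝔸) - 1‖ ≤ αU j)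
        {S : Subgroup 𝔸ˣ}, AvgClosed d L S → (∀ b, U b ∈ S) →
      ∀ {α : ℝ}, 0 ≤ α → α ≤ α₀ →
        (∀ (b : Bond d (towerP L m (n + 1))) (v u : W), ⟪adTransportW φ U b v, u⟫_ℂ = ⟪v, adTransportW φ (fun b => (U b)⁻¹) b u⟫_ℂ) →
        (∀ b, ‖(U b : 𝔸) - 1‖ ≤ α * η) →
        (∀ p : B9SectCLatticeCarrier.Plaq d (towerP L m (n + 1)), ‖(plaqHolU U p : 𝔸) - 1‖ ≤ α * η ^ 2) →
        (∀ x : BondL2K ℂ d (towerP L m (n + 1)) c₀ W,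
            γ₁ * (‖covCurlL2K ℂ c₀ ((η : ℂ))⁻¹ (adTransportW φ (fun _ : Bond d (towerP L m (n + 1)) => (1 : 𝔸ˣ))) x‖ ^ 2 + ‖covDivL2K ℂ c₀ ((η : ℂ))⁻¹ (adTransportW φ fun _ : Bond d (towerP L m (n + 1)) => (1 : 𝔸ˣ)⁻¹) x‖ ^ 2 + ‖x‖ ^ 2) ≤ RCLike.re ⟪x, laplaceAk L m n φ η U hL αU hα1 hU1 hreg τ (c₀ := c₀) (c₁ := c₁) a x⟫_ℂ) ∧
        (∀ x : BondL2K ℂ d (towerP L m (n + 1)) c₀ W,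
            γ₁ * (‖covCurlL2K ℂ c₀ ((η : ℂ))⁻¹ (adTransportW φ (fun _ : Bond d (towerP L m (n + 1)) => (1 : 𝔸ˣ))) x‖ ^ 2 + ‖covDivL2K ℂ c₀ ((η : ℂ))⁻¹ (adTransportW φ fun _ : Bond d (towerP L m (n + 1)) => (1 : 𝔸ˣ)⁻¹) x‖ ^ 2 + ‖x‖ ^ 2) ≤ RCLike.re ⟪x, laplaceAk L m n φ η (fun _ : Bond d (towerP L m (n + 1)) => (1 : 𝔸ˣ)) hL (fun _ => 0) (fun _ => by norm_num)
              (perCfg_UlevOf_one_mem_U1 L m (n + 1)) (norm_Wcx_UlevOf_one_sub_one_le L m (n + 1) (fun _ => 0) (fun _ => le_rfl)) τ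
              (c₀ := c₀) (c₁ := c₁) a x⟫_ℂ) ∧
        (∀ u v : BondL2K ℂ d (towerP L m (n + 1)) c₀ W,
            ‖⟪u, laplaceAk L m n φ η U hL αU hα1 hU1 hreg τ (c₀ := c₀) (c₁ := c₁) a v⟫_ℂ - ⟪u, laplaceAk L m n φ η (fun _ : Bond d (towerP L m (n + 1)) => (1 : 𝔸ˣ)) hL (fun _ => 0) (fun _ => by norm_num)
              (perCfg_UlevOf_one_mem_U1 L m (n + 1)) (norm_Wcx_UlevOf_one_sub_one_le L m (n + 1) (fun _ => 0) (fun _ => le_rfl)) τ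
              (c₀ := c₀) (c₁ := c₁) a v⟫_ℂ‖ ≤
              Θ * α * Real.sqrt (‖covCurlL2K ℂ c₀ ((η : ℂ))⁻¹ (adTransportW φ (fun _ : Bond d (towerP L m (n + 1)) => (1 : 𝔸ˣ))) u‖ ^ 2 + ‖covDivL2K ℂ c₀ ((η : ℂ))⁻¹ (adTransportW φ fun _ : Bond d (towerP L m (n + 1)) => (1 : 𝔸ˣ)⁻¹) u‖ ^ 2 + ‖u‖ ^ 2) * Real.sqrt (‖covCurlL2K ℂ c₀ ((η : ℂ))⁻¹ (adTransportW φ (fun _ : Bond d (towerP L m (n + 1)) => (1 : 𝔸ˣ))) v‖ ^ 2 + ‖covDivL2K ℂ c₀ ((η : ℂ))⁻¹ (adTransportW φ fun _ : Bond d (towerP L m (n + 1)) => (1 : 𝔸ˣ)⁻¹) v‖ ^ 2 + ‖v‖ ^ 2)) := by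
  have hL0 : (0 : ℝ) < L := by exact_mod_cast lt_of_lt_of_le (by norm_num) hL2
  have hr0 : (0 : ℝ) ≤ 1 / (L : ℝ) := by positivity
  have hr1 : 1 / (L : ℝ) < 1 := by rw [div_lt_one hL0]; exact_mod_cast lt_of_lt_of_le (by norm_num) hL2
  -- the packaged `R`-letter and the OWNER's `∃`, opened once at its constant
  obtain ⟨αR, CR, hαR, hCR, HR⟩ := exists_norm_RofUk_sub_RofUk_one_le_diagonal L φ hMφ hMφ' hφ hφ' hr0 hr1
  obtain ⟨α₁, γ₁, Θ, hα₁, hγ₁, hΘ, H⟩ := exists_energy_pair_diagonal_closed L hL φ hMφ hMφ' hφ hφ' ha hr0 hr1 τ hτ hCτ hρw hCR.le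
  -- the α-linear feed below both thresholds
  obtain ⟨T, hT, F⟩ := twoWindows_linear_feed L hL2 (d := d) (𝔸 := 𝔸) (lt_min hα₁ hαR)
  refine ⟨T, γ₁, Θ * (1 + 512 * (d + 1) * (d + 4)), hT, hγ₁, by positivity, ?_⟩
  intro n η hηL c₀ c₁ _ _ hw hρ m _ U αU hα1 hU1 hreg S hS hU α hα0 hαle hRS hUη hpl
  obtain ⟨hβ0, hβ1, hUb, hUη', hpl', hLb, εU, hεU, hUε, hεg⟩ := F m n hS hU hηL hα0 hαle hUη hpl
  have hR := HR n η hηL c₀ c₁ hw m U εU hεU hUε hLb hβ0 (hβ1.trans (min_le_right _ _)) hRS hUb hUη' hεg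
  obtain ⟨h1, h2, h3⟩ := H n η hηL c₀ c₁ hw hρ m U αU hα1 hU1 hreg εU hεU hUε hβ0 (hβ1.trans (min_le_left _ _)) hRS hUb hUη' hpl' hεg hR
  exact ⟨h1, h2, fun u v => (h3 u v).trans_eq (by ring)⟩

end Literature.MathematicalPhysics.QuantumFieldTheory.Balaban1983to89.B9Eq353FormDefectTowerTwoWindows

end
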